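import Mathlib
import Literature.Analysis.OperatorTheory.StablePolynomialInverseSeries
import Summits.ValiantsHypothesis.ValiantsHypothesis.Theorems.ContractivityPricePriceOfContractivityStubSameSizeMonochromeBlocks
import Summits.ValiantsHypothesis.ValiantsHypothesis.Theorems.ContractivityPricePriceOfContractivityStubOneLargeClassSchur
import HarnessLib

/-!
# ♦ one-large-class case — pieces (a₀) `piece_a_blockIndex`, (b) `piece_b_coeffBounds`,
# (c) `piece_c_cauchy`: block indexing, bounds from zero-freeness, Cauchy's coefficient estimate

Crux `PriceOfContractivity` (stmt-ValiantsHypothesis-10583), line `birth`, registered stub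
`stub_stableLifting_oneLargeClass` (♦ for one large colour class + at most two further rows);
this helper file carries three of the six pieces of its proof (the registered piece here is
`piece_b_coeffBounds`; the landing file `…StubOneLargeClass.lean` imports it; the evaluation
helpers come from the landed piece (a) file `…StubOneLargeClassSchur.lean`).

* (a₀) `piece_a_blockIndex`: if all but at most two indices `i : Fin R` carry the colour `x`
  (`Nat.card {i // κ i ≠ x} ≤ 2`), then `Fin R ≃ Fin n ⊕ Fin t` with `n ≤ R`, `t ≤ 2`, the first
  summand the `x`-coloured indices, the second enumerated by `c : Fin t → σ` with `c j ≠ x`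
  (`Equiv.sumCompl`, `Fintype.equivFin`).
* (b) `piece_b_coeffBounds`: let `P = â + Ê₁ X_{c₁} + Ê₃ X_{c₂} + Ê₂ X_{c₁} X_{c₂}`
  (`a = det (1 + ξA) ∈ ℂ[ξ]`, `A ∈ ℂ^{n×n}`, hat = substitution `ξ ↦ X_x`; either all `E_v = 0`
  or `c₁, c₂ ≠ x` with `E₃ = 0` if `c₁ = c₂`) have no zero on the closed polydisc of radius `2`.
  Then for `|ξ| ≤ 2`: `a(ξ) ≠ 0` (evaluate at `ξ e_x`) and `|E_v(ξ)| ≤ |a(ξ)|` — VIETA for the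
  univariate restrictions `u ↦ P(ξ e_x + u e_{c₁} + u e_{c₂}) = a + (E₁ + E₃) u + E₂ u²`,
  `u ↦ a + E₁ u`, `u ↦ a + E₃ u`: a polynomial `α + βu + γu²` (`α ≠ 0`) without zeros in
  `|u| ≤ 2` factors as `α (1 + d₀u)(1 + d₁u)` with `|dᵢ| ≤ 1/2` (eigenvalues of the companion
  matrix, landed `exists_det_one_add_smul_eq_prod`, `norm_le_half_of_prod_ne_zero`), so
  `|β| ≤ |α|`, `|γ| ≤ |α|/4`; and for `|ξ| ≤ 2/(n+1)`:
  `|a(ξ)| = ∏ |1 + λᵢ ξ| ≤ (1 + 1/(n+1))^n ≤ e < 3` (eigenvalues `|λᵢ| ≤ 1/2` of `A`).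
* (c) `piece_c_cauchy`: if `|E(ξ)| ≤ B` on `|ξ| ≤ ρ` (`ρ > 0`) then `|coeff_m E| ≤ B / ρ^m`
  (the coefficient is `(2πi)⁻¹ ∮_{|t|=ρ} E(t) t^{-(m+1)} dt`,
  `Literature…GKVVW.circleIntegral_sum_mul_pow_mul_zpow`).
All folklore.
-/

noncomputable section

-- `Summit.<Summit>.<Problem>` repeats `ValiantsHypothesis` by the tree's layout convention (D-0017).
set_option linter.dupNamespace false

namespace Summit.ValiantsHypothesis.ValiantsHypothesis.Theorems.PriceOfContractivity.OneLargeClass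

section BlockIndex


/-- **Piece (a₀): block indexing.** If all but at most two indices carry the colour `x`, then
`Fin R ≃ Fin n ⊕ Fin t` with `t ≤ 2`, the first block coloured `x` and the second block coloured
by `c : Fin t → σ` with `c j ≠ x`. [folklore] -/
theorem piece_a_blockIndex :
    ∀ {σ : Type} {R : ℕ} (κ : Fin R → σ) (x : σ), Nat.card {i : Fin R // κ i ≠ x} ≤ 2 →
      ∃ (n t : ℕ) (e : Fin R ≃ Fin n ⊕ Fin t) (c : Fin t → σ),
        n ≤ R ∧ t ≤ 2 ∧ (∀ j, c j ≠ x) ∧ ∀ i, κ (e.symm i) = Sum.elim (fun _ => x) c i := by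
  intro σ R κ x h
  classical
  let p : Fin R → Prop := fun i => κ i = x
  have ht : Fintype.card {i // ¬p i} ≤ 2 := by
    rwa [Nat.card_eq_fintype_card] at h
  have hn : Fintype.card {i // p i} ≤ R :=
    (Fintype.card_subtype_le _).trans (by simp)
  let eX : {i // p i} ≃ Fin (Fintype.card {i // p i}) := Fintype.equivFin _
  let eF : {i // ¬p i} ≃ Fin (Fintype.card {i // ¬p i}) := Fintype.equivFin _
  let e : Fin R ≃ Fin (Fintype.card {i // p i}) ⊕ Fin (Fintype.card {i // ¬p i}) :=
    (Equiv.sumCompl p).symm.trans (eX.sumCongr eF)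
  refine ⟨_, _, e, fun j => κ (eF.symm j), hn, ht, fun j => (eF.symm j).2, ?_⟩
  rintro (i | j)
  · show κ (Equiv.sumCompl p ((eX.sumCongr eF).symm (Sum.inl i))) = x
    rw [Equiv.sumCongr_symm, Equiv.sumCongr_apply, Sum.map_inl, Equiv.sumCompl_apply_inl]
    exact (eX.symm i).2
  · show κ (Equiv.sumCompl p ((eX.sumCongr eF).symm (Sum.inr j))) = κ (eF.symm j)
    rw [Equiv.sumCongr_symm, Equiv.sumCongr_apply, Sum.map_inr, Equiv.sumCompl_apply_inr]


end BlockIndex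

section Cauchy

open Complex Metric
open scoped Real


/-- **Piece (c): Cauchy's coefficient estimate for polynomials.**  If `|E(ξ)| ≤ B` on the closed
disc `|ξ| ≤ ρ` (`ρ > 0`), then `|coeff_m E| ≤ B / ρ^m` (orthogonality of `t^k` on the circle of
radius `ρ`). [folklore] -/
theorem piece_c_cauchy :
    ∀ (E : Polynomial ℂ) (ρ B : ℝ), 0 < ρ → (∀ ξ : ℂ, ‖ξ‖ ≤ ρ → ‖E.eval ξ‖ ≤ B) →
      ∀ m : ℕ, ‖E.coeff m‖ ≤ B / ρ ^ m := by
  intro E ρ B hρ hB m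
  classical
  have hE : ∀ t : ℂ, E.eval t = ∑ i ∈ E.support, E.coeff i * t ^ i := fun t => by
    rw [Polynomial.eval_eq_sum, Polynomial.sum_def]
  have hint := Literature.Analysis.OperatorTheory.GKVVW.circleIntegral_sum_mul_pow_mul_zpow
    E.support (fun i => E.coeff i) id m hρ
  have hsum : (∑ i ∈ E.support with id i = m, E.coeff i) = E.coeff m := by
    by_cases hm : m ∈ E.support
    · rw [Finset.sum_eq_single_of_mem m (by simpa using hm)]
      intro i hi him
      exact absurd (Finset.mem_filter.mp hi).2 him
    · rw [Polynomial.notMem_support_iff.mp hm]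
      refine Finset.sum_eq_zero fun i hi => ?_
      obtain ⟨hi1, hi2⟩ := Finset.mem_filter.mp hi
      exact absurd (hi2 ▸ hi1) hm
  rw [hsum] at hint
  have hB0 : 0 ≤ B := le_trans (norm_nonneg _) (hB 0 (by simpa using hρ.le))
  -- bound on the circle
  have hbound : ∀ t ∈ sphere (0 : ℂ) ρ,
      ‖(∑ i ∈ E.support, E.coeff i * t ^ (id i)) * t ^ (-(m + 1 : ℤ))‖ ≤ B * ρ⁻¹ ^ (m + 1) := by
    intro t ht
    have htr : ‖t‖ = ρ := by simpa using ht
    rw [norm_mul, norm_zpow, htr, zpow_neg, ← Nat.cast_succ, zpow_natCast, ← inv_pow]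
    refine mul_le_mul_of_nonneg_right ?_ (by positivity)
    have := hB t htr.le
    rwa [hE t] at this
  have hnorm := circleIntegral.norm_integral_le_of_norm_le_const hρ.le hbound
  rw [hint, norm_mul] at hnorm
  have h2π : ‖(2 * π * I : ℂ)‖ = 2 * π := by simp [Real.pi_pos.le]
  rw [h2π, pow_succ] at hnorm
  have hr' : ρ * (B * (ρ⁻¹ ^ m * ρ⁻¹)) = B / ρ ^ m := by
    rw [inv_pow]; field_simp
  nlinarith [Real.pi_pos, norm_nonneg (E.coeff m), hr']


end Cauchy

section Bounds


open Matrix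
open Summit.ValiantsHypothesis.ValiantsHypothesis.Theorems.PriceOfContractivity.MonochromeBlocks
  (exists_det_one_add_smul_eq_prod norm_le_half_of_prod_ne_zero)

/-! ### Vieta bounds for univariate restrictions -/

/-- Linear Vieta: if `α + βu ≠ 0` for all `|u| ≤ 2` then `|β| ≤ |α| / 2`. [folklore] -/
theorem bnd_norm_le_of_linear_ne_zero {α β : ℂ} (h : ∀ u : ℂ, ‖u‖ ≤ 2 → α + β * u ≠ 0) :
    ‖β‖ ≤ ‖α‖ / 2 := by
  by_contra hlt
  rw [not_le] at hlt
  have hβ : β ≠ 0 := by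
    rintro rfl
    rw [norm_zero] at hlt
    linarith [norm_nonneg α]
  have hβ0 : 0 < ‖β‖ := norm_pos_iff.mpr hβ
  refine h (-(α / β)) ?_ ?_
  · rw [norm_neg, norm_div, div_le_iff₀ hβ0]
    linarith
  · field_simp
    ring

/-- Quadratic Vieta: if `α ≠ 0` and `α + βu + γu² ≠ 0` for all `|u| ≤ 2` then `|β| ≤ |α|` and
`|γ| ≤ |α| / 4` (the inverse roots have modulus `≤ 1/2`). [folklore] -/
theorem bnd_norm_le_of_quadratic_ne_zero {α β γ : ℂ} (hα : α ≠ 0)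
    (h : ∀ u : ℂ, ‖u‖ ≤ 2 → α + β * u + γ * u ^ 2 ≠ 0) :
    ‖β‖ ≤ ‖α‖ ∧ ‖γ‖ ≤ ‖α‖ / 4 := by
  -- companion matrix of `1 + (β/α) u + (γ/α) u²`
  set Mc : Matrix (Fin 2) (Fin 2) ℂ := !![β / α, -1; γ / α, 0] with hMc
  have hdet : ∀ u : ℂ, (1 + u • Mc).det = 1 + u * (β / α) + u ^ 2 * (γ / α) := by
    intro u
    rw [Matrix.det_fin_two]
    simp [hMc]
    ring
  obtain ⟨d, hd⟩ := exists_det_one_add_smul_eq_prod Mc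
  have hne : ∀ u : ℂ, ‖u‖ ≤ 2 → ∏ i, (1 + u * d i) ≠ 0 := by
    intro u hu hz
    rw [← hd, hdet] at hz
    apply h u hu
    have : α + β * u + γ * u ^ 2 = α * (1 + u * (β / α) + u ^ 2 * (γ / α)) := by
      field_simp
    rw [this, hz, mul_zero]
  have hdi : ∀ i, ‖d i‖ ≤ 1 / 2 := norm_le_half_of_prod_ne_zero d hne
  have h1 := hd 1
  have h2 := hd (-1)
  rw [hdet, Fin.prod_univ_two] at h1 h2
  have hγ : γ / α = d 0 * d 1 := by linear_combination (h1 + h2) / 2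
  have hβ : β / α = d 0 + d 1 := by linear_combination (h1 - h2) / 2
  have hα0 : 0 < ‖α‖ := norm_pos_iff.mpr hα
  constructor
  · have : ‖β / α‖ ≤ 1 := by
      rw [hβ]
      exact (norm_add_le _ _).trans (by linarith [hdi 0, hdi 1])
    rwa [norm_div, div_le_iff₀ hα0, one_mul] at this
  · have : ‖γ / α‖ ≤ 1 / 4 := by
      rw [hγ, norm_mul]
      calc ‖d 0‖ * ‖d 1‖ ≤ (1 / 2) * (1 / 2) :=
            mul_le_mul (hdi 0) (hdi 1) (norm_nonneg _) (by norm_num)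
        _ = 1 / 4 := by norm_num
    rw [norm_div, div_le_iff₀ hα0] at this
    linarith

/-! ### Evaluation helpers (`schur_eval_det_one_add_X_smul`, `schur_eval_aeval_X` from the
landed piece (a) file) -/

/-- Points of the closed polydisc stay in it after updating one coordinate inside the disc. -/
theorem bnd_norm_update_le {σ : Type} [DecidableEq σ] {f : σ → ℂ} (hf : ∀ j, ‖f j‖ ≤ 2) (s : σ)
    {v : ℂ} (hv : ‖v‖ ≤ 2) : ∀ j, ‖Function.update f s v j‖ ≤ 2 := by
  intro j
  rw [Function.update_apply]
  split_ifs
  · exact hv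
  · exact hf j

/-! ### The bounds -/

/-- **Piece (b): coefficient-polynomial bounds from zero-freeness.**  If
`P = â + Ê₁ X_{c₁} + Ê₃ X_{c₂} + Ê₂ X_{c₁} X_{c₂}` (as in piece (a), `a = det (1 + ξA)`,
`A ∈ ℂ^{n×n}`) has no zero on the closed polydisc of radius `2`, then on `|ξ| ≤ 2`:
`a(ξ) ≠ 0` and `|E_v(ξ)| ≤ |a(ξ)|` (Vieta for the univariate restrictions
`u ↦ P(ξ, u)`: inverse roots of modulus `≤ 1/2`), and on `|ξ| ≤ 2/(n+1)`:
`|a(ξ)| = ∏ |1 + λᵢ ξ| ≤ (1 + 1/(n+1))^n ≤ 3` (eigenvalues `|λᵢ| ≤ 1/2`). [folklore] -/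
theorem piece_b_coeffBounds :
    ∀ {σ : Type} {n : ℕ} (x c₁ c₂ : σ) (A : Matrix (Fin n) (Fin n) ℂ) (E₁ E₂ E₃ : Polynomial ℂ)
      (P : MvPolynomial σ ℂ),
      (∀ z : σ → ℂ, (∀ j, ‖z j‖ ≤ 2) → MvPolynomial.eval z P ≠ 0) →
      P = Polynomial.aeval (MvPolynomial.X x : MvPolynomial σ ℂ)
              ((1 : Matrix (Fin n) (Fin n) (Polynomial ℂ)) +
                (Polynomial.X : Polynomial ℂ) • A.map (fun a : ℂ => Polynomial.C a)).det +
            Polynomial.aeval (MvPolynomial.X x : MvPolynomial σ ℂ) E₁ * MvPolynomial.X c₁ +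
            Polynomial.aeval (MvPolynomial.X x : MvPolynomial σ ℂ) E₃ * MvPolynomial.X c₂ +
            Polynomial.aeval (MvPolynomial.X x : MvPolynomial σ ℂ) E₂ *
              (MvPolynomial.X c₁ * MvPolynomial.X c₂) →
      ((c₁ ≠ x ∧ c₂ ≠ x ∧ (c₁ = c₂ → E₃ = 0)) ∨ (E₁ = 0 ∧ E₂ = 0 ∧ E₃ = 0)) →
      (∀ ξ : ℂ, ‖ξ‖ ≤ 2 →
        ((1 : Matrix (Fin n) (Fin n) (Polynomial ℂ)) +
            (Polynomial.X : Polynomial ℂ) • A.map (fun a : ℂ => Polynomial.C a)).det.eval ξ ≠ 0 ∧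
        ‖E₁.eval ξ‖ ≤ ‖((1 : Matrix (Fin n) (Fin n) (Polynomial ℂ)) +
            (Polynomial.X : Polynomial ℂ) • A.map (fun a : ℂ => Polynomial.C a)).det.eval ξ‖ ∧
        ‖E₂.eval ξ‖ ≤ ‖((1 : Matrix (Fin n) (Fin n) (Polynomial ℂ)) +
            (Polynomial.X : Polynomial ℂ) • A.map (fun a : ℂ => Polynomial.C a)).det.eval ξ‖ ∧
        ‖E₃.eval ξ‖ ≤ ‖((1 : Matrix (Fin n) (Fin n) (Polynomial ℂ)) +
            (Polynomial.X : Polynomial ℂ) • A.map (fun a : ℂ => Polynomial.C a)).det.eval ξ‖) ∧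
      (∀ ξ : ℂ, ‖ξ‖ ≤ 2 / (n + 1) →
        ‖((1 : Matrix (Fin n) (Fin n) (Polynomial ℂ)) +
            (Polynomial.X : Polynomial ℂ) • A.map (fun a : ℂ => Polynomial.C a)).det.eval ξ‖ ≤ 3) := by
  intro σ n x c₁ c₂ A E₁ E₂ E₃ P hP hPE hside
  classical
  set a : Polynomial ℂ := ((1 : Matrix (Fin n) (Fin n) (Polynomial ℂ)) +
    (Polynomial.X : Polynomial ℂ) • A.map (fun a : ℂ => Polynomial.C a)).det with ha
  have ha_eval : ∀ ξ : ℂ, a.eval ξ = (1 + ξ • A).det := schur_eval_det_one_add_X_smul A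
  have hevalP : ∀ z : σ → ℂ, MvPolynomial.eval z P = a.eval (z x) + E₁.eval (z x) * z c₁ +
      E₃.eval (z x) * z c₂ + E₂.eval (z x) * (z c₁ * z c₂) := by
    intro z
    rw [hPE]
    simp only [map_add, map_mul, schur_eval_aeval_X, MvPolynomial.eval_X]
  have h0 : ∀ j : σ, ‖(0 : σ → ℂ) j‖ ≤ 2 := fun j => by simp
  -- `a(ξ) ≠ 0` on `|ξ| ≤ 2`
  have ha_ne : ∀ ξ : ℂ, ‖ξ‖ ≤ 2 → a.eval ξ ≠ 0 := by
    intro ξ hξ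
    have h := hP (Function.update 0 x ξ) (bnd_norm_update_le h0 x hξ)
    rw [hevalP] at h
    rcases hside with ⟨h1, h2, -⟩ | ⟨r1, r2, r3⟩
    · simpa [Function.update_of_ne h1, Function.update_of_ne h2] using h
    · simpa [r1, r2, r3] using h
  -- eigenvalues of `A`
  obtain ⟨d, hd⟩ := exists_det_one_add_smul_eq_prod A
  have hd2 : ∀ i, ‖d i‖ ≤ 1 / 2 := by
    refine norm_le_half_of_prod_ne_zero d fun t ht => ?_
    rw [← hd, ← ha_eval]
    exact ha_ne t ht
  refine ⟨fun ξ hξ => ⟨ha_ne ξ hξ, ?_⟩, fun ξ hξ => ?_⟩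
  · -- Vieta
    rcases hside with ⟨h1, h2, h3⟩ | ⟨r1, r2, r3⟩
    · -- the diagonal restriction `u ↦ a + (E₁ + E₃) u + E₂ u²`
      have hquad : ∀ u : ℂ, ‖u‖ ≤ 2 →
          a.eval ξ + (E₁.eval ξ + E₃.eval ξ) * u + E₂.eval ξ * u ^ 2 ≠ 0 := by
        intro u hu
        have h := hP (Function.update (Function.update (Function.update 0 x ξ) c₁ u) c₂ u)
          (bnd_norm_update_le (bnd_norm_update_le (bnd_norm_update_le h0 x hξ) c₁ hu) c₂ hu)
        rw [hevalP] at h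
        have hx : Function.update (Function.update (Function.update (0 : σ → ℂ) x ξ) c₁ u) c₂ u x
            = ξ := by
          rw [Function.update_of_ne h2.symm, Function.update_of_ne h1.symm, Function.update_self]
        have hc1 : Function.update (Function.update (Function.update (0 : σ → ℂ) x ξ) c₁ u) c₂ u c₁
            = u := by
          rcases eq_or_ne c₁ c₂ with h12 | h12
          · rw [h12, Function.update_self]
          · rw [Function.update_of_ne h12, Function.update_self]
        have hc2 : Function.update (Function.update (Function.update (0 : σ → ℂ) x ξ) c₁ u) c₂ u c₂
            = u := by rw [Function.update_self]
        rw [hx, hc1, hc2] at h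
        convert h using 1
        ring
      obtain ⟨hsum, hE₂⟩ := bnd_norm_le_of_quadratic_ne_zero (ha_ne ξ hξ) hquad
      have hE₂' : ‖E₂.eval ξ‖ ≤ ‖a.eval ξ‖ := hE₂.trans (by linarith [norm_nonneg (a.eval ξ)])
      rcases eq_or_ne c₁ c₂ with h12 | h12
      · -- same colour: `E₃ = 0`
        have hE3 : E₃ = 0 := h3 h12
        rw [hE3, Polynomial.eval_zero, add_zero] at hsum
        rw [hE3, Polynomial.eval_zero, norm_zero]
        exact ⟨hsum, hE₂', norm_nonneg _⟩
      · -- distinct colours: the two coordinate restrictions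
        have hlin : ∀ (c c' : σ) (E E' : Polynomial ℂ), c ≠ x → c' ≠ x → c ≠ c' →
            (∀ z : σ → ℂ, MvPolynomial.eval z P = a.eval (z x) + E.eval (z x) * z c +
              E'.eval (z x) * z c' + E₂.eval (z x) * (z c * z c')) →
            ‖E.eval ξ‖ ≤ ‖a.eval ξ‖ := by
          intro c c' E E' hc hc' hcc' hev
          have hl : ∀ u : ℂ, ‖u‖ ≤ 2 → a.eval ξ + E.eval ξ * u ≠ 0 := by
            intro u hu
            have h := hP (Function.update (Function.update 0 x ξ) c u)
              (bnd_norm_update_le (bnd_norm_update_le h0 x hξ) c hu)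
            rw [hev, Function.update_of_ne hc.symm, Function.update_self, Function.update_self,
              Function.update_of_ne hcc'.symm, Function.update_of_ne hc'] at h
            simpa using h
          exact (bnd_norm_le_of_linear_ne_zero hl).trans (by linarith [norm_nonneg (a.eval ξ)])
        refine ⟨hlin c₁ c₂ E₁ E₃ h1 h2 h12 hevalP, hE₂', hlin c₂ c₁ E₃ E₁ h2 h1 h12.symm ?_⟩
        intro z; rw [hevalP]; ring
    · simp [r1, r2, r3]
  · -- the small disc
    rw [ha_eval, hd, norm_prod]
    have hξ2 : ‖ξ‖ ≤ 2 / ((n : ℝ) + 1) := hξ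
    have hfac : ∀ i, ‖1 + ξ * d i‖ ≤ 1 + 1 / ((n : ℝ) + 1) := by
      intro i
      refine (norm_add_le _ _).trans ?_
      rw [norm_one, norm_mul]
      have : ‖ξ‖ * ‖d i‖ ≤ 2 / ((n : ℝ) + 1) * (1 / 2) :=
        mul_le_mul hξ2 (hd2 i) (norm_nonneg _) (by positivity)
      have h' : 2 / ((n : ℝ) + 1) * (1 / 2) = 1 / ((n : ℝ) + 1) := by ring
      linarith
    calc ∏ i, ‖1 + ξ * d i‖ ≤ ∏ _i : Fin n, (1 + 1 / ((n : ℝ) + 1)) :=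
          Finset.prod_le_prod (fun i _ => norm_nonneg _) fun i _ => hfac i
      _ = (1 + 1 / ((n : ℝ) + 1)) ^ n := by simp
      _ ≤ 3 := by
          -- `(1 + 1/(n+1))^n ≤ exp (n/(n+1)) ≤ e < 3`
          have hn1 : (0 : ℝ) < (n : ℝ) + 1 := by positivity
          have h1 : 1 + 1 / ((n : ℝ) + 1) ≤ Real.exp (1 / ((n : ℝ) + 1)) := by
            have := Real.add_one_le_exp (1 / ((n : ℝ) + 1)); linarith
          calc (1 + 1 / ((n : ℝ) + 1)) ^ n ≤ (Real.exp (1 / ((n : ℝ) + 1))) ^ n :=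
                pow_le_pow_left₀ (by positivity) h1 n
            _ = Real.exp (n * (1 / ((n : ℝ) + 1))) := (Real.exp_nat_mul _ n).symm
            _ ≤ Real.exp 1 := by
                refine Real.exp_le_exp.mpr ?_
                rw [mul_one_div, div_le_one hn1]
                linarith
            _ ≤ 3 := by linarith [Real.exp_one_lt_d9]


end Bounds

end Summit.ValiantsHypothesis.ValiantsHypothesis.Theorems.PriceOfContractivity.OneLargeClass
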